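import Mathlib
import HarnessLib
import Summits.HubbardSuperconductivity.HubbardSuperconductivity.Theorems.WeakCouplingBCSKlVHPeakLeaf
import Summits.HubbardSuperconductivity.HubbardSuperconductivity.Theorems.WeakCouplingBCSKlConeOrder

/-!
# The κ-anatomy of the Kohn–Luttinger rival margin — typed sketch for the round-8 crux idea
# «kl-ratio-lock-logslope» (planner hubbard-klscan-idea-1 g8, lens «anomaly»; bears on the certificate half
# `WeakCouplingBCS.WcbcsKohnLuttingerB1g` = stmt-HubbardSuperconductivity-0158, HQ1 (ii) and its exception (β))

THE LEVER.  Write the rival margin of the scan as a PRODUCT of the `d`-wave SCALE and a rival SHAPE factor,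
`m(μ; t′) = |λ_B1g| · (1 − κ_max)`, `κ_χ := λ_χ / λ_B1g` (§2, PROVED identity).  HQ1 (ii) on a side-segment is then the
pairwise inequality «`d`-wave GAIN beats rival SHAPE LOSS», `(1 + g)(1 − η) ≥ 1` (§3, PROVED both ways: order, and the
reversed order = the hump).  The anatomy of `κ` (floats; §4–§5 state them as Props, instances in docstrings only):
* at `t′ = 0` the `p`-wave ratio is LOCKED, `κ_E(μ, 0) = 0.212 ± 0.009` for every hole doping `δ ∈ [0.05, 0.30]` (exact-χ₀
  engine; `λ_E` and `λ_B1g` both vary ×7.5) — so on the `E`-bound cells (ii) at `t′ = 0` IS `d`-wave monotonicity (idea-2's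
  cone gain) plus ONE two-sided window word on ONE rival (§4 `rivalMarginTP_mono_of_lock`, PROVED);
* on the `M` side (`μ > 4t′`) of a `t′ < 0` row, toward the van Hove level `κ_E` runs UP (the `p`-wave is VH-fed and `t′`-inert
  to ±20 %, the `d`-wave is nesting-limited) while `κ_A2g` runs DOWN (saddle-blind) — a binding SWITCH `A2g → E` inside the
  segment; past the switch (ii) holds iff the `d`-wave gain still beats the `E` shape loss, which FAILS for `t′ < t′_h`,
  `t′_h ∈ (−0.275, −0.25)` (engine rows `t′ = −0.25 / −0.275 / −0.30`: monotone / hump / hump) — the director's exception (β)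
  is the grid's one visible row of a 2D strip, certifiable by the landed three-cell peak leaf `KlVHPeak.MarginPeakTP` (§5).

Honest framing: floats are floats; nothing here asserts a margin at `t′ ≠ 0`, `K₃`, `U₀`, the window or superconductivity; a
Kohn–Luttinger `O(U²)` channel statement is not ODLRO and nothing here proves superconductivity in the Hubbard model.  0 sorry.
References: [RaghuKivelsonScalapino2010] §III + Fig. 3 and the near-VH `V_eff` asymptotics (arXiv:1002.0591 p. 7: `χ(0) ∼ ln`,
`χ(Q) ∼ ln·ln|t/2t′|`); R. Hlubina, Phys. Rev. B 59 (1999) 9600 (KL phase diagram of the `t`–`t′` model); landed tree vocabulary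
`KlVHPeak.rivalMarginTP`, `KlConeOrder.b1gStrengthTP`, `KlVHPeak.MarginPeakTP`, `KlVHPeak.hq1ii_negative_of_marginPeak`.
-/

noncomputable section

set_option linter.dupNamespace false

open Set
open Literature.MathematicalPhysics.QuantumLattice
open Summit.HubbardSuperconductivity.HubbardSuperconductivity.Theorems
open Summit.HubbardSuperconductivity.HubbardSuperconductivity.Theorems.KlNotB1g
open Summit.HubbardSuperconductivity.HubbardSuperconductivity.Theorems.KlVHPeak
open Summit.HubbardSuperconductivity.HubbardSuperconductivity.Theorems.KlConeOrder

namespace Summit.HubbardSuperconductivity.HubbardSuperconductivity.Theorems.KlKappaAnatomy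

/-! ## §1 Vocabulary: channel bottoms, rival gaps `G_χ`, ratios `κ_χ` of the `t`–`t′` band at `U = 1` -/

/-- `λ_χ(μ; t′) := channelInf ε_{t′} μ 1 χ`, the `O(U²)` Kohn–Luttinger bottom of the irrep `χ` (`U = 1` units). -/
def bottomTP (tp μ : ℝ) (χ : D4Irrep) : ℝ := channelInf (squareDispersion 1 tp) μ 1 χ

/-- The rival gap `G_χ(μ; t′) := λ_χ − λ_B1g` (`> 0` iff `B1g` leads `χ`). -/
def rivalGapTP (tp μ : ℝ) (χ : D4Irrep) : ℝ := bottomTP tp μ χ - bottomTP tp μ .B1g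

/-- The ratio `κ_χ(μ; t′) := λ_χ / λ_B1g` (dimensionless; `< 1` iff `B1g` leads `χ` when `λ_B1g < 0`). -/
def ratioTP (tp μ : ℝ) (χ : D4Irrep) : ℝ := bottomTP tp μ χ / bottomTP tp μ .B1g

/-- The binding ratio `κ_max := max(κ_A2g, κ_B2g, κ_E)` over the tree's rivals (`KlNotB1g.IsRival` = `{A2g, B2g, E}`). -/
def ratioMaxTP (tp μ : ℝ) : ℝ := max (max (ratioTP tp μ .A2g) (ratioTP tp μ .B2g)) (ratioTP tp μ .E)

/-- The tree's `t′` rival margin is the least rival gap (definitional). -/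
theorem rivalMarginTP_eq_min_gap (tp μ : ℝ) :
    rivalMarginTP tp μ = min (min (rivalGapTP tp μ .A2g) (rivalGapTP tp μ .B2g)) (rivalGapTP tp μ .E) := by
  simp only [rivalMarginTP, rivalGapTP, bottomTP, min_sub_sub_right]

/-- `KlConeOrder.b1gStrengthTP` is `−λ_B1g` in this vocabulary. -/
theorem b1gStrengthTP_eq (tp μ : ℝ) : b1gStrengthTP tp μ = -bottomTP tp μ .B1g := rfl

/-! ## §2 The factorisation `G_χ = |λ_B1g|·(1 − κ_χ)` and `m = |λ_B1g|·(1 − κ_max)` (PROVED, needs only `λ_B1g < 0`) -/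

/-- Rival gap = `d`-wave scale × shape factor. -/
theorem rivalGapTP_eq_strength_mul (tp μ : ℝ) (χ : D4Irrep) (hd : bottomTP tp μ .B1g < 0) :
    rivalGapTP tp μ χ = b1gStrengthTP tp μ * (1 - ratioTP tp μ χ) := by
  have hne : bottomTP tp μ .B1g ≠ 0 := ne_of_lt hd
  rw [b1gStrengthTP_eq, rivalGapTP, ratioTP]
  field_simp
  ring

/-- **The product form of the margin**: `m(μ; t′) = |λ_B1g(μ; t′)| · (1 − κ_max(μ; t′))` whenever `λ_B1g < 0`. -/
theorem rivalMarginTP_eq_strength_mul (tp μ : ℝ) (hd : bottomTP tp μ .B1g < 0) :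
    rivalMarginTP tp μ = b1gStrengthTP tp μ * (1 - ratioMaxTP tp μ) := by
  have hpos : 0 ≤ b1gStrengthTP tp μ := by rw [b1gStrengthTP_eq]; linarith
  rw [rivalMarginTP_eq_min_gap, rivalGapTP_eq_strength_mul tp μ _ hd, rivalGapTP_eq_strength_mul tp μ _ hd,
    rivalGapTP_eq_strength_mul tp μ _ hd, ratioMaxTP, ← min_sub_sub_left, ← min_sub_sub_left,
    ← mul_min_of_nonneg _ _ hpos, ← mul_min_of_nonneg _ _ hpos]

/-- `B1g` leads the rival `χ` strictly iff `κ_χ < 1` (given `λ_B1g < 0`). -/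
theorem rivalGapTP_pos_iff (tp μ : ℝ) (χ : D4Irrep) (hd : bottomTP tp μ .B1g < 0) :
    0 < rivalGapTP tp μ χ ↔ ratioTP tp μ χ < 1 := by
  have hs : 0 < b1gStrengthTP tp μ := by rw [b1gStrengthTP_eq]; linarith
  rw [rivalGapTP_eq_strength_mul tp μ χ hd]
  constructor
  · intro h
    by_contra hc
    have : b1gStrengthTP tp μ * (1 - ratioTP tp μ χ) ≤ 0 :=
      mul_nonpos_of_nonneg_of_nonpos hs.le (by linarith [not_lt.mp hc])
    linarith
  · intro h
    exact mul_pos hs (by linarith)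

/-! ## §3 The pairwise criterion «`d`-wave gain beats rival shape loss» (PROVED, generic real inequalities)

`f` = the scale `|λ_B1g|`, `φ` = the shape factor `1 − κ_max`; `x` = the level farther from half filling / from the VH level,
`y` = the nearer one.  GAIN: `(1 + g)·f x ≤ f y` (the shape of idea-2's `KlConeOrder.ConeGain`).  SHAPE LOSS: `(1 − η)·φ x ≤ φ y`. -/

/-- **Order from gain ≥ loss**: `(1+g)(1−η) ≥ 1` ⇒ `f x · φ x ≤ f y · φ y`. -/
theorem prod_le_of_gain_beats_loss {fx fy φx φy g η : ℝ} (hfx : 0 ≤ fx) (hφx : 0 ≤ φx) (hη : η ≤ 1) (hg : 0 ≤ 1 + g)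
    (hgain : (1 + g) * fx ≤ fy) (hloss : (1 - η) * φx ≤ φy) (hcrit : 1 ≤ (1 + g) * (1 - η)) :
    fx * φx ≤ fy * φy := by
  have hfy : 0 ≤ fy := le_trans (mul_nonneg hg hfx) hgain
  calc fx * φx ≤ (1 + g) * (1 - η) * (fx * φx) := le_mul_of_one_le_left (mul_nonneg hfx hφx) hcrit
    _ = (1 + g) * fx * ((1 - η) * φx) := by ring
    _ ≤ fy * ((1 - η) * φx) := mul_le_mul_of_nonneg_right hgain (mul_nonneg (by linarith) hφx)
    _ ≤ fy * φy := mul_le_mul_of_nonneg_left hloss hfy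

/-- **Reversed order from loss > gain** (the hump mechanism): if the scale grows by AT MOST `1 + g` while the shape factor
drops by AT LEAST `1 − η` and `(1+g)(1−η) < 1`, the product strictly DEcreases: `f y · φ y < f x · φ x`. -/
theorem prod_lt_of_loss_beats_gain {fx fy φx φy g η : ℝ} (hfx : 0 < fx) (hφx : 0 < φx) (hφy : 0 ≤ φy) (hg : 0 ≤ 1 + g)
    (hgain : fy ≤ (1 + g) * fx) (hloss : φy ≤ (1 - η) * φx) (hcrit : (1 + g) * (1 - η) < 1) :
    fy * φy < fx * φx := by
  have h1 : fy * φy ≤ (1 + g) * fx * φy := mul_le_mul_of_nonneg_right hgain hφy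
  have h2 : (1 + g) * fx * φy ≤ (1 + g) * fx * ((1 - η) * φx) :=
    mul_le_mul_of_nonneg_left hloss (by nlinarith)
  have h3 : (1 + g) * fx * ((1 - η) * φx) < fx * φx := by nlinarith [mul_pos hfx hφx]
  linarith

/-! ## §4 The `t′ = 0` LOCK of the `p`-wave ratio and what it does for HQ1 (ii) (Props NOT asserted; consequences PROVED)

Floats (exact-χ₀ sector engine, `M = 256`, converged; evidence RESULTS-r8 §3): `κ_E(μ(δ), 0)` = 0.203, 0.213, 0.2195, 0.220,
0.2206, 0.2194, 0.2163, 0.212, 0.2117, 0.2025, 0.218 at `δ` = 0.05, 0.075, 0.10, 0.125, 0.15, 0.175, 0.20, 0.20(bis), 0.225,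
0.25, 0.30 — i.e. `0.212 ± 0.009` while `λ_B1g` runs from `−0.687` to `−0.091`; `κ_A2g` falls 0.33 → 0.04 and the even twins'
ratio rises 0.02 → 0.18 over the same window; `E` is the binding rival for `δ ∈ [0.175, 0.30]`; the lock opens at `t′ ≠ 0`. -/

/-- **Ratio lock** on a `μ`-window at hopping `t′`: `|λ_E − κ₀·λ_B1g| ≤ η·|λ_B1g|`, i.e. `|κ_E − κ₀| ≤ η` (two one-sided window
words on ONE rival with RELATIVE thresholds: an `E` Rayleigh ceiling against a `B1g` floor, an `E` floor against a `B1g` ceiling —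
the dual record shapes `KlVHPeak.KLRivalCeilingAtTP` / `KLB1gFloorAtTP` / `KLB1gCeilingAtTP` with `r, l, u` proportional). [folklore] -/
def RatioLock (tp κ₀ η : ℝ) (W : Set ℝ) : Prop :=
  ∀ μ ∈ W, |bottomTP tp μ .E - κ₀ * bottomTP tp μ .B1g| ≤ η * b1gStrengthTP tp μ

/-- `E` is the binding rival on `W` (`λ_E ≤ λ_A2g` and `λ_E ≤ λ_B2g`; float at `t′ = 0`: `δ ∈ [0.175, 0.325]`). [cite: RaghuKivelsonScalapino2010, §III Fig. 2] -/
def EBinds (tp : ℝ) (W : Set ℝ) : Prop :=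
  ∀ μ ∈ W, bottomTP tp μ .E ≤ bottomTP tp μ .A2g ∧ bottomTP tp μ .E ≤ bottomTP tp μ .B2g

/-- The round-8 instance proposed as an item: `t′ = 0`, `κ₀ = 53/250 = 0.212`, `η = 1/50` (slack ×2 over the measured 0.0095),
window `μ ∈ [μ(0.30), μ(0.05)] = [−721/1000, −39/500]`. -/
def RatioLockT0R8 : Prop := RatioLock 0 (53 / 250) (1 / 50) (Icc (-(721 / 1000 : ℝ)) (-(39 / 500 : ℝ)))

/-- Where `E` binds, the margin IS the `E` gap. -/
theorem rivalMarginTP_eq_gapE_of_EBinds {tp : ℝ} {W : Set ℝ} (hE : EBinds tp W) {μ : ℝ} (hμ : μ ∈ W) :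
    rivalMarginTP tp μ = rivalGapTP tp μ .E := by
  obtain ⟨hA, hB⟩ := hE μ hμ
  rw [rivalMarginTP_eq_min_gap]
  have h1 : rivalGapTP tp μ .E ≤ rivalGapTP tp μ .A2g := by unfold rivalGapTP; linarith
  have h2 : rivalGapTP tp μ .E ≤ rivalGapTP tp μ .B2g := by unfold rivalGapTP; linarith
  rw [min_eq_right (le_min h1 h2)]

/-- Under the lock the `E` gap is pinched between `(1 − κ₀ ∓ η)·|λ_B1g|`. -/
theorem gapE_bounds_of_lock {tp κ₀ η : ℝ} {W : Set ℝ} (hL : RatioLock tp κ₀ η W) {μ : ℝ} (hμ : μ ∈ W) :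
    (1 - κ₀ - η) * b1gStrengthTP tp μ ≤ rivalGapTP tp μ .E ∧
      rivalGapTP tp μ .E ≤ (1 - κ₀ + η) * b1gStrengthTP tp μ := by
  have h := abs_le.mp (hL μ hμ)
  rw [b1gStrengthTP_eq] at h ⊢
  unfold rivalGapTP
  constructor <;> nlinarith [h.1, h.2]

/-- **HQ1 (ii) at a locked hopping, pairwise form (PROVED).**  On an `E`-bound, ratio-locked window, any two levels whose `d`-wave
strengths are ordered with gain `g ≥ 2η/(1 − κ₀ − η)` have ordered margins.  With the round-8 floats (`κ₀ = 0.212`, `η = 0.02`)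
the threshold gain is 5.2 %; consecutive `t′ = 0` grid cells (`Δδ = 0.025`) differ by 15–20 % in `|λ_B1g|`.  So at `t′ = 0` on
`δ ∈ [0.175, 0.30]` the monotonicity of the margin reduces to the monotonicity of ONE channel (idea-2's `ConeGain` / `B1gStrengthMonoOn`)
plus ONE window word (`RatioLock`) — no per-pair rival drift norms. -/
theorem rivalMarginTP_mono_of_lock {tp κ₀ η g : ℝ} {W : Set ℝ} (hL : RatioLock tp κ₀ η W) (hE : EBinds tp W)
    (hκ : κ₀ + η ≤ 1) {x y : ℝ} (hx : x ∈ W) (hy : y ∈ W)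
    (hfx : 0 ≤ b1gStrengthTP tp x) (hgain : (1 + g) * b1gStrengthTP tp x ≤ b1gStrengthTP tp y)
    (hcrit : (1 - κ₀ + η) ≤ (1 + g) * (1 - κ₀ - η)) :
    rivalMarginTP tp x ≤ rivalMarginTP tp y := by
  rw [rivalMarginTP_eq_gapE_of_EBinds hE hx, rivalMarginTP_eq_gapE_of_EBinds hE hy]
  obtain ⟨_, hxup⟩ := gapE_bounds_of_lock hL hx
  obtain ⟨hylo, _⟩ := gapE_bounds_of_lock hL hy
  calc rivalGapTP tp x .E ≤ (1 - κ₀ + η) * b1gStrengthTP tp x := hxup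
    _ ≤ (1 + g) * (1 - κ₀ - η) * b1gStrengthTP tp x := mul_le_mul_of_nonneg_right hcrit hfx
    _ = (1 - κ₀ - η) * ((1 + g) * b1gStrengthTP tp x) := by ring
    _ ≤ (1 - κ₀ - η) * b1gStrengthTP tp y := mul_le_mul_of_nonneg_left hgain (by linarith)
    _ ≤ rivalGapTP tp y .E := hylo

/-- The same in idea-2's currency at `t′ = 0`: a cone gain `ConeGain μa μb g` (`(1+g)|λ_B1g(μb)| ≤ |λ_B1g(μa)|`) with
`g` above the lock threshold orders the tree's `KlNotB1g.rivalMargin`. -/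
theorem rivalMargin_mono_of_lock_coneGain {κ₀ η g μa μb : ℝ} {W : Set ℝ} (hL : RatioLock 0 κ₀ η W) (hE : EBinds 0 W)
    (hκ : κ₀ + η ≤ 1) (ha : μa ∈ W) (hb : μb ∈ W) (hfb : 0 ≤ b1gStrength μb)
    (hc : ConeGain μa μb g) (hcrit : (1 - κ₀ + η) ≤ (1 + g) * (1 - κ₀ - η)) :
    rivalMargin μb ≤ rivalMargin μa := by
  have h := rivalMarginTP_mono_of_lock (tp := 0) hL hE hκ hb ha hfb hc hcrit
  simpa [rivalMarginTP_zero] using h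

/-! ## §5 The `t′ < 0` anatomy on the `M` side of the van Hove level (Props NOT asserted; engine floats in the docstrings)

`M` side of the row `t′`: `μ ∈ (4t′ + 1/40, b]` (the scan's VH exclusion strip removed), `d := μ − 4t′` the distance to the VH
level.  Engine (numerical-ρ sector engine, M = 256, Nx = 192; ENGINE-TABLE-r8): along `d ↓` (toward VH)
`t′ = −0.30`: `κ_E` = .098 .155 .220 .310 .443, `κ_A2g` = .251 .191 .155 .109 .083 at `d` = .294 .190 .144 .100 .061 — switch
`A2g → E` in `d ∈ (0.144, 0.190)`; margin .2147 .2582 .2604 .2383 .1966 (HUMP at the switch);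
`t′ = −0.275`: `κ_E` = .143 .266 .390, `κ_A2g` = .214 .123 .079 at `d` = .20 .10 .05; margin .2708 .2948 .2699 (HUMP);
`t′ = −0.25`: `κ_E` = .144 .180 .237 .330, `κ_A2g` = .232 .192 .140 .077 at `d` = .20 .15 .10 .05; margin .2836 .3257 .3428 .3463
(MONOTONE, saturating); `t′ = −0.15`: `κ_E` = .144 .188 .222, `κ_A2g` = .353 .225 .135 at `d` = .20 .10 .05; margin .272 .456 .592
(MONOTONE).  The `p`-wave bottom at fixed `d` is `t′`-inert to ±20 % for `t′ ∈ [−0.35, −0.15]` while `|λ_B1g|`, `|λ_A2g|` fall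
×3–5 and the even twins rise ×5 (same table). -/

/-- The `M` side-segment of the row `t′` up to the level `b`. -/
def MSide (tp b : ℝ) : Set ℝ := Icc (4 * tp + 1 / 40) b

/-- **(A1) the `p`-wave ratio runs UP toward the van Hove level on the `M` side** (antitone in `μ`). [cite: RaghuKivelsonScalapino2010, §III Fig. 3] -/
def PwaveRatioRunsUp (tp b : ℝ) : Prop := AntitoneOn (fun μ => ratioTP tp μ .E) (MSide tp b)

/-- **(A2) the `g`-wave (`A2g`) ratio runs DOWN toward the van Hove level on the `M` side** (monotone in `μ`). [cite: RaghuKivelsonScalapino2010, §III Fig. 3] -/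
def NestingRatioRunsDown (tp b : ℝ) : Prop := MonotoneOn (fun μ => ratioTP tp μ .A2g) (MSide tp b)

/-- **(A3) a binding switch level** on the `M` side: `λ_E = λ_A2g` at some `μ_× ∈ MSide tp b` (engine brackets: `t′ = −0.30`:
`μ_× ∈ (−1.056, −1.010)`; `−0.275`: `(−1.0, −0.9)`; `−0.25`: `≈ −0.85` (`λ_A2g = −0.0774`, `λ_E = −0.0724` there); `−0.15`:
`(−0.55, −0.50)`). [folklore] -/
def BindingSwitch (tp b : ℝ) : Prop := ∃ μ ∈ MSide tp b, bottomTP tp μ .E = bottomTP tp μ .A2g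

/-- **(A4) the switch hump of the row `t′ = −3/10`** in the landed peak currency `KlVHPeak.MarginPeakTP` at the levels of the
dopings `0.225 < 0.175 < 0.10` (all three outside the VH strip: `d` = .061, .144, .294), drop `g = 1/50` (engine: .1966 + .02 ≤
.2604 ≥ .2147 + .02).  Certifiable by `KlVHPeak.marginPeakTP_of_records` (one selection word at `δ = 0.175`, two dual words). -/
def SwitchHumpRow_tm03 : Prop :=
  MarginPeakTP (-3 / 10) (klMuOfDopingTP (-3 / 10) (9 / 40)) (klMuOfDopingTP (-3 / 10) (7 / 40))
    (klMuOfDopingTP (-3 / 10) (1 / 10)) (1 / 50)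

/-- **(A4′) the switch hump of the row `t′ = −11/40`** at the explicit levels `μ = −21/20, −1, −9/10` (`d` = .05, .10, .20),
drop `g = 1/100` (engine: .2699 + .01 ≤ .2948 ≥ .2708 + .01) — the row BETWEEN grid rows that the criterion predicted. -/
def SwitchHumpRow_tm0275 : Prop := MarginPeakTP (-11 / 40) (-21 / 20) (-1) (-9 / 10) (1 / 100)

/-- **(A5) no hump at `t′ = −1/4`**: the margin is antitone in `μ` (monotone toward VH) on the `M` side up to `μ = −4/5`
(engine: .3463 ≥ .3428 ≥ .3257 ≥ .2836 at `μ` = −.95, −.90, −.85, −.80).  With (A4′) this brackets the onset `t′_h ∈ (−11/40, −1/4)`. -/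
def MSideMonotone_tm025 : Prop := AntitoneOn (rivalMarginTP (-1 / 4)) (MSide (-1 / 4) (-4 / 5))

/-- **What (A4) decides for HQ1 (ii) (PROVED from the landed peak reading):** the margin of the row `t′ = −3/10` is neither
monotone nor antitone in `δ` on `[0.10, 0.225]` — a sub-segment of the `M` SIDE-segment, away from the van Hove level: the
exception (β) is not a van Hove peak but an interior switch hump. -/
theorem hq1ii_beta_of_switchHump (h : SwitchHumpRow_tm03) :
    ¬ MonotoneOn (fun δ => rivalMarginTP (-3 / 10) (klMuOfDopingTP (-3 / 10) δ)) (Icc (1 / 10 : ℝ) (9 / 40)) ∧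
      ¬ AntitoneOn (fun δ => rivalMarginTP (-3 / 10) (klMuOfDopingTP (-3 / 10) δ)) (Icc (1 / 10 : ℝ) (9 / 40)) := by
  have hp : MarginPeakTP (-3 / 10) (klMuOfDopingTP (-3 / 10) (1 / 10)) (klMuOfDopingTP (-3 / 10) (7 / 40))
      (klMuOfDopingTP (-3 / 10) (9 / 40)) (1 / 50) := ⟨h.2, h.1⟩
  exact hq1ii_negative_of_marginPeak (by norm_num) (by norm_num) (by norm_num) hp

/-- **The switch-hump mechanism in the product form (PROVED instance of §3):** on an `E`-bound pair of `M`-side levels with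
`λ_B1g < 0`, if the `d`-wave strength grows toward VH by at most `1 + g` while `1 − κ_E` drops by at least `1 − η` with
`(1+g)(1−η) < 1`, the margin strictly DROPS toward VH.  (Engine, `t′ = −0.3`, `d` .144 → .061: `1 + g = 1.057`, `1 − η = 0.714`,
product 0.75 < 1 ⇒ drop .2604 → .1966 ✓; `t′ = −0.25`, `d` .10 → .05: 1.151 × 0.878 = 1.01 ≥ 1 ⇒ no drop, .3428 → .3463 ✓.) -/
theorem margin_drops_of_loss_beats_gain {tp x y g η : ℝ} {W : Set ℝ} (hE : EBinds tp W) (hx : x ∈ W) (hy : y ∈ W)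
    (hdx : bottomTP tp x .B1g < 0) (hdy : bottomTP tp y .B1g < 0)
    (hφx : ratioTP tp x .E < 1) (hφy : ratioTP tp y .E ≤ 1) (hg : 0 ≤ 1 + g)
    (hgain : b1gStrengthTP tp y ≤ (1 + g) * b1gStrengthTP tp x)
    (hloss : 1 - ratioTP tp y .E ≤ (1 - η) * (1 - ratioTP tp x .E)) (hcrit : (1 + g) * (1 - η) < 1) :
    rivalMarginTP tp y < rivalMarginTP tp x := by
  rw [rivalMarginTP_eq_gapE_of_EBinds hE hx, rivalMarginTP_eq_gapE_of_EBinds hE hy,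
    rivalGapTP_eq_strength_mul tp x _ hdx, rivalGapTP_eq_strength_mul tp y _ hdy]
  have hsx : 0 < b1gStrengthTP tp x := by rw [b1gStrengthTP_eq]; linarith
  exact prod_lt_of_loss_beats_gain hsx (by linarith) (by linarith) hg hgain hloss hcrit

end Summit.HubbardSuperconductivity.HubbardSuperconductivity.Theorems.KlKappaAnatomy

end
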